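import Summits.QuantumFields.YangMills.Theorems.FluctuationComparisonRegPrIntLOrganTangentGoodSetTailPlaquetteUnion
import Literature.MathematicalPhysics.QuantumFieldTheory.Balaban1983to89.T4PairDerivBridge
import Literature.Probability.Moments.HerbstArgument
import HarnessLib

/-!
# Route `UnitScaleTilt` — crux `FluctuationComparisonRegPrIntL` (stmt-QuantumFields-20520, rung R3), PATH-B organ: «A5's POINTWISE GOOD-SET TAIL FROM A FIBRE ENTROPY
# LETTER, BY HERBST» — at every law point `V` and every `t ∈ [0,1]`, the `ŵ_t(V,·)`-mass of the complement of a small-field window is at most `#Plaq · e^{−(θ′−m₀)²∕(4cH)}`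
# given, per plaquette, the entropy inequality for `e^{l·dist1(plaqHol_p ∘ Φ(V,·))}` under `ŵ_t(V,·)` (constant `cH`) and a mean bound `m₀ ≤ θ′`
# (SPEC (xv-b) «A5 TAIL THRESHOLD»; UV3-NODE §106.2 ∕ §106 ADDENDUM 2 road (HS); LEAD RULING №63 «J-EXT STANDS»)

Cell `ym3-torus` (YM ladder rung R3 = continuum `SU(2)` Yang–Mills on the three-torus — a RUNG: NOT d = 4, NOT infinite volume, NOT a mass gap, NOT Clay).
Width seat `ym-ust-20520-w4` (gen 27), (xv-b) lane (after ✓p832486 … ✓p833898, ✓p835245 ∕ ✓p835459); `--kind proof --supports stmt-QuantumFields-20520 --as helper`,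
count-neutral, DEFINITION-FREE, no registry ∕ binder ∕ `Lines/` edit, default heartbeats, `autoImplicit false`.

WHAT.  A5's Good-set clause (ROW-sq v0.4ᴱ :151; ✓p833568 `htail₀ ∕ htail₁`) asks, at EVERY `θ_j∕4`-window law point `Xw` and every `t ∈ [0,1]`, for ONE INTENSIVE scalar
`ES` with `∫_{Goodᶜ} ŵ_t(Xw,·) dτ ≤ ES`, `Good = {z | PlaqSmall θ′ (Φ(Xw,z))}` (`θ′ = θ_Ts∕4 − 3·Db·rc`, ✓`…OrganTangentGoodSetMargin`) — POINTWISE in `Xw` (ideator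
`ym-r3-idea-1` g33 №3: the sup currency is forced at the row tie, the stub text and the terminal).  `ym3-torus-px19` g24's UV3-NODE §106 ADDENDUM 2 locates the pointwise
cell on road (HS): a logarithmic Sobolev inequality for the cut fibre law `ŵ_t(V,·)` (uniform in `t` because `log ŵ_t` is a convex combination of the endpoint
log-densities minus a constant) gives, by HERBST's argument, Gaussian tails of every Lipschitz fibre observable, in particular of the one-plaquette size
`ψ_p = dist1(plaqHol_p ∘ Φ(V,·))`.  This file kernel-checks the HERBST half of that sentence, consuming the LSI only through the already-integrated entropy inequality:
* §1 [folklore] ★`weighted_herbst_tail` — the tree's ✓`Literature.Probability.Moments.HerbstArgument.herbst_laplace_and_tail_bound` ([BakryGentilLedoux2014] Prop. 5.4.1)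
  RE-READ IN DENSITY FORM: `τ` any measure, a density `w ≥ 0` with `∫ w dτ = 1`, `ψ` bounded measurable, `c > 0`, and the ENTROPY LETTER
  `∀ l, ∫ e^{lψ}(lψ)·w dτ − (∫ e^{lψ}·w dτ)·log(∫ e^{lψ}·w dτ) ≤ c·l²·∫ e^{lψ}·w dτ` ⟹ `∫_{r ≤ ψ − m} w dτ ≤ e^{−r²∕(4c)}`, `m = ∫ ψ·w dτ` (the law `w·τ` as the probability
  measure `τ.withDensity w`); ★`weighted_herbst_threshold_tail`: with `m ≤ m₀ ≤ θ′`, `∫_{θ′ ≤ ψ} w dτ ≤ e^{−(θ′−m₀)²∕(4c)}`.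
* §2 IN THE FRAME'S LETTERS (binders = ✓`wgt_normalised`'s VERBATIM, a window point `V`, `t`, threshold `θ′`, letters `cH`, `m₀`):
  ★`setIntegral_wgt_plaqLarge_le_exp` — per plaquette `p`, from **(Ent-p)** (the entropy letter for `ψ_p` under `ŵ_t(V,·)`, constant `cH`) and **(mean-p)**
  (`∫ ψ_p·ŵ_t(V,·) dτ ≤ m₀ ≤ θ′`): `∫_{θ′ ≤ ψ_p} ŵ_t(V,·) dτ ≤ e^{−(θ′−m₀)²∕(4cH)}`; and with ✓p833898 `setIntegral_wgt_compl_plaqSmall_le_sum` (the complement of the window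
  is the union of the single-plaquette events) ★★`setIntegral_wgt_compl_plaqSmall_le_card_mul_exp`:
  `∫ z in {z | ¬ PlaqSmall θ′ (Φ (V, z))}, ŵ_t(V,z) dτ ≤ #Plaq_Ts · exp(−(θ′ − m₀)²∕(4·cH))` — EXACTLY the shape of A5's `htail_t` with the intensive scalar
  `ES := #Plaq_Ts·e^{−(θ′−m₀)²∕(4cH)}`.  SCALE (ideator `ym-r3-idea-1` g33 №4, display asked): with `θ′ ≤ θ_Ts∕4 = g_Ts·p(g_Ts)∕4` the exponent is
  `≤ g_Ts²·p(g_Ts)²∕(64·cH)`, so this is print's per-plaquette currency `e^{−c′·p(g_Ts)²}` ([Balaban1985UV3] (7)∕(71)) IFF `cH ≲ g_Ts²∕C` — on road (HS) THAT is the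
  content (`cH = ℓ_ψ²∕(2α)` with the conditional fibre law `α`-log-concave at the propagator scale `α ≍ g_Ts^{−2}` in the directions `ψ_p` feels); `cH = O(1)` is VACUOUS.
So BY KERNEL: (xv-b)'s POINTWISE cell ⟸ {(Ent-p), (mean-p)} uniformly in `(t, V, p)`.  On road (HS), (Ent-p) ⟸ LSI(`α`) for `ŵ_t(V,·)` ⟸ uniform `α`-log-concavity of the two
ENDPOINT cut fibre laws in Bałaban's chart (interpolates in `t`) + Bakry–Émery ([BakryGentilLedoux2014] Prop. 5.7.1) + the chart-Lipschitz modulus of `ψ_p`; (mean-p) is a D0-chart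
letter (`m₀ ≍ O(g_Ts)`).  NO Harnack step, NO local conditional lower bound, NO `J`∕KL letter (RULING №63-conform: `ŵ_t` is used as a law, never compared to `ŵ₀`).

HONEST FRAMING: [folklore] measure theory (Herbst via the tree, a change of density, a union bound via ✓p833898) over the frame's HYPOTHESIS letters; (Ent-p), (mean-p), `cH`,
`m₀` are LETTERS; road (HS) itself (uniform log-concavity of the cut fibre law in d = 3) is NEW and NOT claimed (px5 §76.3 (h1) «log-concave cut» caveat applies to `mwCut`);
nothing of Bałaban's analysis is asserted or proved; (xv-b) is NOT discharged (REDUCED to two letters per plaquette); `SpreadFibreLawHJ(sq)`(ᴱ) ∕ `OrganDischargeInputsHJ(sq)`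
(every edition) UNDISCHARGED; the five registered stubs of `Lines/runpair_organ.lean` (registry 3732b7df, untouched), crux 20520 and `YM3TorusSU2` are NOT proved; rung R3 =
SU(2) YM₃ on T³ at fixed lattice data — NOT d = 4, NOT infinite volume, NOT a mass gap, NOT Clay; the Yang–Mills mass gap is NOT proved.
-/

set_option autoImplicit false

noncomputable section

namespace Summit.QuantumFields.YangMills.Theorems.OrganTangentGoodSetTailOfFibreEntropy

open MeasureTheory Filter Topology
open scoped ENNReal NNReal
open Literature.MathematicalPhysics.QuantumFieldTheory.Balaban1983to89 T3ContinuumYM3Torus T3NestedUnitLaws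
  T3UnitLawDensityEML T4Continuum T3UnitScaleTilt T3LevelShift T3TiltDescent
open Literature.MathematicalPhysics.QuantumFieldTheory.Balaban1983to89.B12ContinuousTransportInvarianceOn (continuous_dist1_SU continuous_plaqHol_SU)
open Literature.MathematicalPhysics.QuantumFieldTheory.Balaban1983to89.T4PairDerivBridge (dist1_le_two_specialUnitaryGroup)
open Summit.QuantumFields.YangMills.Theorems.FluctuationComparisonRegPrIntLRunpairOrganFibreLaw (mwCut wNum wgt)
open Summit.QuantumFields.YangMills.Theorems.OrganTangentFibreWeightNormalisation (wgt_normalised wgt_nonneg)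
open Summit.QuantumFields.YangMills.Theorems.OrganTangentGoodSetTailPlaquetteUnion (setIntegral_wgt_compl_plaqSmall_le_sum)

/-! ## §1 Herbst's argument in density form -/

/-- ★ **HERBST TAIL FOR A LAW GIVEN BY A DENSITY** — `τ` any measure on `Z`, `w ≥ 0` measurable and integrable with `∫ w dτ = 1`, `ψ` bounded measurable, `c > 0`;
if for every real `l` the entropy inequality `∫ e^{lψ}(lψ)·w dτ − (∫ e^{lψ}·w dτ)·log(∫ e^{lψ}·w dτ) ≤ c·l²·∫ e^{lψ}·w dτ` holds (what a log-Sobolev inequality for the law `w·τ`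
gives at `f = e^{lψ∕2}`), then `∫_{r ≤ ψ − m} w dτ ≤ e^{−r²∕(4c)}` for every `r ≥ 0`, with `m = ∫ ψ·w dτ`.  The tree's ✓`herbst_laplace_and_tail_bound` applied to the probability
measure `τ.withDensity w`. [cite: BakryGentilLedoux2014, Prop. 5.4.1 and (5.4.2)] -/
theorem weighted_herbst_tail {Z : Type*} [MeasurableSpace Z] (τ : Measure Z) {w ψ : Z → ℝ}
    (hwm : Measurable w) (hw0 : ∀ z, 0 ≤ w z) (hwi : Integrable w τ) (hw1 : ∫ z, w z ∂τ = 1)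
    (hψ : Measurable ψ) (hbdd : ∃ C : ℝ, ∀ z, |ψ z| ≤ C) {c : ℝ} (hc : 0 < c)
    (hEnt : ∀ l : ℝ, ∫ z, Real.exp (l * ψ z) * (l * ψ z) * w z ∂τ -
      (∫ z, Real.exp (l * ψ z) * w z ∂τ) * Real.log (∫ z, Real.exp (l * ψ z) * w z ∂τ) ≤
        c * l ^ 2 * ∫ z, Real.exp (l * ψ z) * w z ∂τ)
    (r : ℝ) (hr : 0 ≤ r) :
    ∫ z in {z | r ≤ ψ z - ∫ y, ψ y * w y ∂τ}, w z ∂τ ≤ Real.exp (-r ^ 2 / (4 * c)) := by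
  -- the law as a probability measure
  set f : Z → ℝ≥0 := fun z => (w z).toNNReal with hf
  have hfm : Measurable f := hwm.real_toNNReal
  have hfc : ∀ z, (f z : ℝ) = w z := fun z => Real.coe_toNNReal _ (hw0 z)
  have hfi : Integrable (fun z => (f z : ℝ)) τ := hwi.congr (Eventually.of_forall fun z => (hfc z).symm)
  set ν : Measure Z := τ.withDensity (fun z => (f z : ℝ≥0∞)) with hν
  have hint : ∀ g : Z → ℝ, ∫ z, g z ∂ν = ∫ z, g z * w z ∂τ := by
    intro g
    rw [hν, integral_withDensity_eq_integral_smul hfm]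
    refine integral_congr_ae (Eventually.of_forall fun z => ?_)
    simp only [NNReal.smul_def, smul_eq_mul, hfc, mul_comm]
  have hνuniv : ν Set.univ = 1 := by
    rw [hν, withDensity_apply _ MeasurableSet.univ, Measure.restrict_univ, lintegral_coe_eq_integral _ hfi]
    simp_rw [hfc, hw1, ENNReal.ofReal_one]
  haveI : IsProbabilityMeasure ν := ⟨hνuniv⟩
  have hEnt' : ∀ l : ℝ, ∫ y, Real.exp (l * ψ y) * (l * ψ y) ∂ν -
      (∫ y, Real.exp (l * ψ y) ∂ν) * Real.log (∫ y, Real.exp (l * ψ y) ∂ν) ≤ c * l ^ 2 * ∫ y, Real.exp (l * ψ y) ∂ν := by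
    intro l; rw [hint, hint]; exact hEnt l
  have hH := (Literature.Probability.Moments.herbst_laplace_and_tail_bound ν hψ hbdd hc hEnt').2 r hr
  -- translate `ν.real` back to a weighted `τ`-integral
  rw [hint ψ] at hH
  have hS : MeasurableSet {z | r ≤ ψ z - ∫ y, ψ y * w y ∂τ} := measurableSet_le measurable_const (hψ.sub_const _)
  rw [measureReal_def, hν, withDensity_apply _ hS, lintegral_coe_eq_integral _ hfi.integrableOn,
    ENNReal.toReal_ofReal (integral_nonneg fun z => NNReal.coe_nonneg _)] at hH
  simp_rw [hfc] at hH
  exact hH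

/-- ★ **… THRESHOLD FORM** — under the same letters plus a mean bound `∫ ψ·w dτ ≤ m₀` and a threshold `θ′ ≥ m₀`: `∫_{θ′ ≤ ψ} w dτ ≤ e^{−(θ′ − m₀)²∕(4c)}`
(`{θ′ ≤ ψ} ⊆ {θ′ − m₀ ≤ ψ − m}`). [cite: BakryGentilLedoux2014, Prop. 5.4.1 and (5.4.2)] -/
theorem weighted_herbst_threshold_tail {Z : Type*} [MeasurableSpace Z] (τ : Measure Z) {w ψ : Z → ℝ}
    (hwm : Measurable w) (hw0 : ∀ z, 0 ≤ w z) (hwi : Integrable w τ) (hw1 : ∫ z, w z ∂τ = 1)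
    (hψ : Measurable ψ) (hbdd : ∃ C : ℝ, ∀ z, |ψ z| ≤ C) {c : ℝ} (hc : 0 < c)
    (hEnt : ∀ l : ℝ, ∫ z, Real.exp (l * ψ z) * (l * ψ z) * w z ∂τ -
      (∫ z, Real.exp (l * ψ z) * w z ∂τ) * Real.log (∫ z, Real.exp (l * ψ z) * w z ∂τ) ≤
        c * l ^ 2 * ∫ z, Real.exp (l * ψ z) * w z ∂τ)
    {m₀ θ' : ℝ} (hm₀ : ∫ z, ψ z * w z ∂τ ≤ m₀) (hθ' : m₀ ≤ θ') :
    ∫ z in {z | θ' ≤ ψ z}, w z ∂τ ≤ Real.exp (-(θ' - m₀) ^ 2 / (4 * c)) := by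
  have hsub : {z | θ' ≤ ψ z} ⊆ {z | θ' - m₀ ≤ ψ z - ∫ y, ψ y * w y ∂τ} := by
    intro z hz
    simp only [Set.mem_setOf_eq] at hz ⊢
    linarith
  calc ∫ z in {z | θ' ≤ ψ z}, w z ∂τ ≤ ∫ z in {z | θ' - m₀ ≤ ψ z - ∫ y, ψ y * w y ∂τ}, w z ∂τ :=
        setIntegral_mono_set hwi.integrableOn (Eventually.of_forall hw0) hsub.eventuallyLE
    _ ≤ Real.exp (-(θ' - m₀) ^ 2 / (4 * c)) := weighted_herbst_tail τ hwm hw0 hwi hw1 hψ hbdd hc hEnt (θ' - m₀) (by linarith)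

/-! ## §2 In the frame's letters: the per-plaquette tail and the Good-set tail, pointwise in the law point -/

/-- ★ **PER-PLAQUETTE LARGE-FIELD TAIL UNDER `ŵ_t(V,·)` FROM (Ent-p) + (mean-p)** — in the frame's letters (binders of ✓`wgt_normalised`, a window point `V`, any real `t`,
a plaquette `p` of the height-`Ts` lattice, `ψ_p(z) := dist1 (plaqHol (Φ (V, z)) p)`): if the entropy letter **(Ent-p)** holds for `ψ_p` under the density `ŵ_t(V,·)` with
constant `cH > 0`, and **(mean-p)** `∫ ψ_p·ŵ_t(V,·) dτ ≤ m₀ ≤ θ′`, then `∫ z in {z | θ′ ≤ dist1 (plaqHol (Φ (V, z)) p)}, ŵ_t(V,z) dτ ≤ exp(−(θ′ − m₀)²∕(4·cH))`.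
(`ψ_p` is measurable and bounded by `2`; `ŵ_t(V,·)` is a `τ`-density by ✓`wgt_normalised`.) [cite: BakryGentilLedoux2014, Prop. 5.4.1 and (5.4.2)] -/
theorem setIntegral_wgt_plaqLarge_le_exp (F : T3Family) (γ b₀ p₀ : ℝ) (j Ts : ℕ) (hjTs : j + 1 ≤ Ts)
    (ρ ρ' : (i : ℕ) → GaugeField (F.P i) 0 ↥(Matrix.specialUnitaryGroup (Fin 2) ℂ) → ℝ) (hρm : Measurable (ρ Ts)) (hρ'm : Measurable (ρ' Ts))
    (hρc : ContinuousOn (ρ Ts) {U | PlaqSmall (θBal F.L γ b₀ p₀ Ts) U}) (hρ'c : ContinuousOn (ρ' Ts) {U | PlaqSmall (θBal F.L γ b₀ p₀ Ts) U})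
    (hρpos : ∀ U, PlaqSmall (θBal F.L γ b₀ p₀ Ts) U → 0 < ρ Ts U ∧ 0 < ρ' Ts U) (hθ : 0 < θBal F.L γ b₀ p₀ Ts)
    (hχc : Continuous (mwCut F γ b₀ p₀ j Ts)) (hχ0 : ∀ U, 0 ≤ mwCut F γ b₀ p₀ j Ts U)
    (hχsupp : ∀ U, mwCut F γ b₀ p₀ j Ts U ≠ 0 → ∀ (n : ℕ) (hjn : j + 1 ≤ n) (hnK : n ≤ Ts), PlaqSmall (24 / 25 * θBal F.L γ b₀ p₀ n) (descendTo F ℰp n Ts hnK U))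
    (hχpos : ∀ U, (∀ (n : ℕ) (hjn : j + 1 ≤ n) (hnK : n ≤ Ts), PlaqSmall (24 / 25 * θBal F.L γ b₀ p₀ n) (descendTo F ℰp n Ts hnK U)) → 0 < mwCut F γ b₀ p₀ j Ts U)
    {Z : Type} [MeasurableSpace Z] (τ : Measure Z) [IsProbabilityMeasure τ]
    (Φ : GaugeField (F.P j) 0 ↥(Matrix.specialUnitaryGroup (Fin 2) ℂ) × Z → GaugeField (F.P Ts) 0 ↥(Matrix.specialUnitaryGroup (Fin 2) ℂ))
    (J : GaugeField (F.P j) 0 ↥(Matrix.specialUnitaryGroup (Fin 2) ℂ) × Z → ℝ≥0)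
    (hΦm : Measurable Φ) (hJm : Measurable J) (CJ : ℝ) (hJle : ∀ V z, (J (V, z) : ℝ) ≤ CJ)
    (hpos : ∀ V, PlaqSmall (θBal F.L γ b₀ p₀ j) V →
      0 < ∫⁻ z in {z | (∀ (n : ℕ) (hjn : j + 1 ≤ n) (hnK : n ≤ Ts), PlaqSmall (24 / 25 * θBal F.L γ b₀ p₀ n) (descendTo F ℰp n Ts hnK (Φ (V, z))))},
        (J (V, z) : ℝ≥0∞) ∂τ)
    (t : ℝ) (V : GaugeField (F.P j) 0 ↥(Matrix.specialUnitaryGroup (Fin 2) ℂ)) (hV : PlaqSmall (θBal F.L γ b₀ p₀ j) V)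
    (p : Plaq (F.P Ts) 0) {cH m₀ θ' : ℝ} (hcH : 0 < cH)
    (hEnt : ∀ l : ℝ, ∫ z, Real.exp (l * dist1 (GaugeField.plaqHol (Φ (V, z)) p)) * (l * dist1 (GaugeField.plaqHol (Φ (V, z)) p)) * wgt F γ b₀ p₀ j Ts ρ ρ' τ Φ J t V z ∂τ -
      (∫ z, Real.exp (l * dist1 (GaugeField.plaqHol (Φ (V, z)) p)) * wgt F γ b₀ p₀ j Ts ρ ρ' τ Φ J t V z ∂τ)
        * Real.log (∫ z, Real.exp (l * dist1 (GaugeField.plaqHol (Φ (V, z)) p)) * wgt F γ b₀ p₀ j Ts ρ ρ' τ Φ J t V z ∂τ) ≤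
      cH * l ^ 2 * ∫ z, Real.exp (l * dist1 (GaugeField.plaqHol (Φ (V, z)) p)) * wgt F γ b₀ p₀ j Ts ρ ρ' τ Φ J t V z ∂τ)
    (hmean : ∫ z, dist1 (GaugeField.plaqHol (Φ (V, z)) p) * wgt F γ b₀ p₀ j Ts ρ ρ' τ Φ J t V z ∂τ ≤ m₀) (hθ' : m₀ ≤ θ') :
    ∫ z in {z | θ' ≤ dist1 (GaugeField.plaqHol (Φ (V, z)) p)}, wgt F γ b₀ p₀ j Ts ρ ρ' τ Φ J t V z ∂τ ≤ Real.exp (-(θ' - m₀) ^ 2 / (4 * cH)) := by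
  classical
  haveI : BorelSpace (GaugeField (F.P Ts) 0 ↥(Matrix.specialUnitaryGroup (Fin 2) ℂ)) :=
    Literature.MathematicalPhysics.QuantumFieldTheory.Balaban1983to89.T3OrbitAverage.instBorelSpaceGaugeField
  have hN := wgt_normalised F γ b₀ p₀ j Ts hjTs ρ ρ' hρm hρ'm hρc hρ'c hρpos hθ hχc hχ0 hχsupp hχpos τ Φ J hΦm hJm CJ hJle hpos t V hV
  have hw0 := wgt_nonneg F γ b₀ p₀ j Ts hjTs ρ ρ' hρpos hθ hχ0 hχsupp τ Φ J t V
  -- measurability of the density `ŵ_t(V,·)`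
  have hVz : Measurable fun z : Z => ((V, z) : GaugeField (F.P j) 0 ↥(Matrix.specialUnitaryGroup (Fin 2) ℂ) × Z) := measurable_const.prodMk measurable_id
  have hΦm1 : Measurable fun z => Φ (V, z) := hΦm.comp hVz
  have hJm1 : Measurable fun z => (J (V, z) : ℝ) := (hJm.comp hVz).coe_nnreal_real
  have hwNm : Measurable fun z => wNum F γ b₀ p₀ j Ts ρ ρ' Φ J t V z := by
    have e : (fun z => wNum F γ b₀ p₀ j Ts ρ ρ' Φ J t V z)
        = fun z => mwCut F γ b₀ p₀ j Ts (Φ (V, z)) * (ρ Ts (Φ (V, z)) ^ t * ρ' Ts (Φ (V, z)) ^ (1 - t)) * (J (V, z) : ℝ) := by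
      funext z; simp only [wNum, Real.rpow_eq_pow]
    rw [e]
    exact ((hχc.measurable.comp hΦm1).mul (((hρm.comp hΦm1).pow_const t).mul ((hρ'm.comp hΦm1).pow_const (1 - t)))).mul hJm1
  have hwm : Measurable fun z => wgt F γ b₀ p₀ j Ts ρ ρ' τ Φ J t V z := by
    have e : (fun z => wgt F γ b₀ p₀ j Ts ρ ρ' τ Φ J t V z)
        = fun z => wNum F γ b₀ p₀ j Ts ρ ρ' Φ J t V z / ∫ z', wNum F γ b₀ p₀ j Ts ρ ρ' Φ J t V z' ∂τ := by
      funext z; simp only [wgt]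
    rw [e]
    exact hwNm.div_const _
  -- the observable `ψ_p` is measurable and bounded by `2`
  have hψm : Measurable fun z => dist1 (GaugeField.plaqHol (Φ (V, z)) p) :=
    ((continuous_dist1_SU (N := 2)).comp (continuous_plaqHol_SU (N := 2) p)).measurable.comp hΦm1
  have hψb : ∃ C : ℝ, ∀ z, |dist1 (GaugeField.plaqHol (Φ (V, z)) p)| ≤ C :=
    ⟨2, fun z => by
      rw [abs_of_nonneg (GaugeGroup.dist1_nonneg _)]
      exact dist1_le_two_specialUnitaryGroup _⟩
  exact weighted_herbst_threshold_tail τ hwm hw0 hN.2.2.1 hN.2.2.2 hψm hψb hcH hEnt hmean hθ'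

/-- ★★ **A5's POINTWISE GOOD-SET TAIL FROM THE FIBRE ENTROPY LETTERS** — in the frame's letters (binders of ✓`wgt_normalised`, a window point `V`, any real `t`, a
threshold `θ′`, letters `cH > 0` and `m₀ ≤ θ′`): if **(Ent-p)** and **(mean-p)** hold for EVERY plaquette `p` of the height-`Ts` lattice (uniformly: same `cH`, `m₀`), then
`∫ z in {z | ¬ PlaqSmall θ′ (Φ (V, z))}, ŵ_t(V,z) dτ ≤ #Plaq_Ts · exp(−(θ′ − m₀)²∕(4·cH))`
— the shape of A5's `htail` slot in the ORIGINAL A5 door ✓p823618 `jtBracket_sq_of_hdisp_crude` at `Xw := V` (and of ✓p833568's `htail₀ ∕ htail₁`) with the intensive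
scalar `ES := #Plaq_Ts · e^{−(θ′−m₀)²∕(4cH)}`, POINTWISE in `V`; no endpoint reduction, no `J`.  The entropy letter is the MINIMAL Herbst input (weaker than LSI(`α`) +
`ψ_p` `ℓ`-Lipschitz, which gives it with `cH ≍ ℓ²∕α`); on road (HS) `cH` is `t`-UNIFORM because `α`-log-concavity of the endpoint cut fibre laws interpolates in `t`
(§106 ADDENDUM 2 (a)), and the CONTENT is the scale `cH ≲ g_Ts²∕C` (`cH = O(1)` makes `ES ≈ #Plaq_Ts`, vacuous).  Per-plaquette Herbst (above) + the union bound
✓`setIntegral_wgt_compl_plaqSmall_le_sum`. [cite: BakryGentilLedoux2014, Prop. 5.4.1 and (5.4.2)] -/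
theorem setIntegral_wgt_compl_plaqSmall_le_card_mul_exp (F : T3Family) (γ b₀ p₀ : ℝ) (j Ts : ℕ) (hjTs : j + 1 ≤ Ts)
    (ρ ρ' : (i : ℕ) → GaugeField (F.P i) 0 ↥(Matrix.specialUnitaryGroup (Fin 2) ℂ) → ℝ) (hρm : Measurable (ρ Ts)) (hρ'm : Measurable (ρ' Ts))
    (hρc : ContinuousOn (ρ Ts) {U | PlaqSmall (θBal F.L γ b₀ p₀ Ts) U}) (hρ'c : ContinuousOn (ρ' Ts) {U | PlaqSmall (θBal F.L γ b₀ p₀ Ts) U})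
    (hρpos : ∀ U, PlaqSmall (θBal F.L γ b₀ p₀ Ts) U → 0 < ρ Ts U ∧ 0 < ρ' Ts U) (hθ : 0 < θBal F.L γ b₀ p₀ Ts)
    (hχc : Continuous (mwCut F γ b₀ p₀ j Ts)) (hχ0 : ∀ U, 0 ≤ mwCut F γ b₀ p₀ j Ts U)
    (hχsupp : ∀ U, mwCut F γ b₀ p₀ j Ts U ≠ 0 → ∀ (n : ℕ) (hjn : j + 1 ≤ n) (hnK : n ≤ Ts), PlaqSmall (24 / 25 * θBal F.L γ b₀ p₀ n) (descendTo F ℰp n Ts hnK U))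
    (hχpos : ∀ U, (∀ (n : ℕ) (hjn : j + 1 ≤ n) (hnK : n ≤ Ts), PlaqSmall (24 / 25 * θBal F.L γ b₀ p₀ n) (descendTo F ℰp n Ts hnK U)) → 0 < mwCut F γ b₀ p₀ j Ts U)
    {Z : Type} [MeasurableSpace Z] (τ : Measure Z) [IsProbabilityMeasure τ]
    (Φ : GaugeField (F.P j) 0 ↥(Matrix.specialUnitaryGroup (Fin 2) ℂ) × Z → GaugeField (F.P Ts) 0 ↥(Matrix.specialUnitaryGroup (Fin 2) ℂ))
    (J : GaugeField (F.P j) 0 ↥(Matrix.specialUnitaryGroup (Fin 2) ℂ) × Z → ℝ≥0)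
    (hΦm : Measurable Φ) (hJm : Measurable J) (CJ : ℝ) (hJle : ∀ V z, (J (V, z) : ℝ) ≤ CJ)
    (hpos : ∀ V, PlaqSmall (θBal F.L γ b₀ p₀ j) V →
      0 < ∫⁻ z in {z | (∀ (n : ℕ) (hjn : j + 1 ≤ n) (hnK : n ≤ Ts), PlaqSmall (24 / 25 * θBal F.L γ b₀ p₀ n) (descendTo F ℰp n Ts hnK (Φ (V, z))))},
        (J (V, z) : ℝ≥0∞) ∂τ)
    (t : ℝ) (V : GaugeField (F.P j) 0 ↥(Matrix.specialUnitaryGroup (Fin 2) ℂ)) (hV : PlaqSmall (θBal F.L γ b₀ p₀ j) V)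
    {cH m₀ θ' : ℝ} (hcH : 0 < cH)
    (hEnt : ∀ (p : Plaq (F.P Ts) 0) (l : ℝ),
      ∫ z, Real.exp (l * dist1 (GaugeField.plaqHol (Φ (V, z)) p)) * (l * dist1 (GaugeField.plaqHol (Φ (V, z)) p)) * wgt F γ b₀ p₀ j Ts ρ ρ' τ Φ J t V z ∂τ -
      (∫ z, Real.exp (l * dist1 (GaugeField.plaqHol (Φ (V, z)) p)) * wgt F γ b₀ p₀ j Ts ρ ρ' τ Φ J t V z ∂τ)
        * Real.log (∫ z, Real.exp (l * dist1 (GaugeField.plaqHol (Φ (V, z)) p)) * wgt F γ b₀ p₀ j Ts ρ ρ' τ Φ J t V z ∂τ) ≤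
      cH * l ^ 2 * ∫ z, Real.exp (l * dist1 (GaugeField.plaqHol (Φ (V, z)) p)) * wgt F γ b₀ p₀ j Ts ρ ρ' τ Φ J t V z ∂τ)
    (hmean : ∀ p : Plaq (F.P Ts) 0, ∫ z, dist1 (GaugeField.plaqHol (Φ (V, z)) p) * wgt F γ b₀ p₀ j Ts ρ ρ' τ Φ J t V z ∂τ ≤ m₀) (hθ' : m₀ ≤ θ') :
    ∫ z in {z | ¬ PlaqSmall θ' (Φ (V, z))}, wgt F γ b₀ p₀ j Ts ρ ρ' τ Φ J t V z ∂τ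
      ≤ (Fintype.card (Plaq (F.P Ts) 0) : ℝ) * Real.exp (-(θ' - m₀) ^ 2 / (4 * cH)) := by
  classical
  have hU := setIntegral_wgt_compl_plaqSmall_le_sum F γ b₀ p₀ j Ts hjTs ρ ρ' hρm hρ'm hρc hρ'c hρpos hθ hχc hχ0 hχsupp hχpos τ Φ J hΦm hJm CJ hJle hpos
    t θ' V hV
  have hP : ∀ p : Plaq (F.P Ts) 0, ∫ z in {z | θ' ≤ dist1 (GaugeField.plaqHol (Φ (V, z)) p)}, wgt F γ b₀ p₀ j Ts ρ ρ' τ Φ J t V z ∂τ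
      ≤ Real.exp (-(θ' - m₀) ^ 2 / (4 * cH)) := fun p =>
    setIntegral_wgt_plaqLarge_le_exp F γ b₀ p₀ j Ts hjTs ρ ρ' hρm hρ'm hρc hρ'c hρpos hθ hχc hχ0 hχsupp hχpos τ Φ J hΦm hJm CJ hJle hpos t V hV p hcH
      (hEnt p) (hmean p) hθ'
  refine hU.trans ?_
  calc ∑ p : Plaq (F.P Ts) 0, ∫ z in {z | θ' ≤ dist1 (GaugeField.plaqHol (Φ (V, z)) p)}, wgt F γ b₀ p₀ j Ts ρ ρ' τ Φ J t V z ∂τ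
      ≤ ∑ _p : Plaq (F.P Ts) 0, Real.exp (-(θ' - m₀) ^ 2 / (4 * cH)) := Finset.sum_le_sum fun p _ => hP p
    _ = (Fintype.card (Plaq (F.P Ts) 0) : ℝ) * Real.exp (-(θ' - m₀) ^ 2 / (4 * cH)) := by
        rw [Finset.sum_const, nsmul_eq_mul, Finset.card_univ]

end Summit.QuantumFields.YangMills.Theorems.OrganTangentGoodSetTailOfFibreEntropy

end
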